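import Literature.NumberTheory.EllipticCurves.HidaFamilyGaloisRepDatum
import Literature.NumberTheory.EllipticCurves.OchiaiTwoVariableSelmerDual
import Literature.NumberTheory.EllipticCurves.GlobalMinimalModel
import Literature.NumberTheory.EllipticCurves.LocalTorsionMultiplicativeProofs
import Literature.NumberTheory.EllipticCurves.ModularityVersionApProofs
import Literature.NumberTheory.DiophantineGeometry.MinimalDiscriminantProofs
import Literature.NumberTheory.GaloisRepresentations.DecompositionGroupOfCompletion
import Summits.BirchSwinnertonDyer.BirchSwinnertonDyer.Theorems.Rank1ResidualX9Defs
import Summits.BirchSwinnertonDyer.BirchSwinnertonDyer.Theorems.OneSidedTwistSqueezeX9KatoDivisibilityX9ULedgerDefs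
import Summits.BirchSwinnertonDyer.BirchSwinnertonDyer.Theorems.OneSidedTwistSqueezeX9KatoDivisibilityX9ULedgerAdditiveInertia
import Summits.BirchSwinnertonDyer.BirchSwinnertonDyer.Theorems.OneSidedTwistSqueezeX9KatoDivisibilityX9ULedgerTateMonodromyDigits
import Summits.BirchSwinnertonDyer.BirchSwinnertonDyer.Theorems.OneSidedTwistSqueezeX9KatoDivisibilityX9ULedgerTameKummer
import Summits.BirchSwinnertonDyer.BirchSwinnertonDyer.Theorems.OneSidedTwistSqueezeX9KatoDivisibilityX9ULedgerSpecialisationKernels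
import Summits.BirchSwinnertonDyer.BirchSwinnertonDyer.Theorems.OneSidedTwistSqueezeX9KatoDivisibilityX9ULedgerWeightTwoTest
import Summits.BirchSwinnertonDyer.BirchSwinnertonDyer.Theorems.OneSidedTwistSqueezeX9KatoDivisibilityX9ULedgerPrincipalPoint
import Summits.BirchSwinnertonDyer.BirchSwinnertonDyer.Theorems.OneSidedTwistSqueezeX9KatoDivisibilityX9ULedgerTameMonodromy
import Mathlib.NumberTheory.Padics.PadicVal.Basic

set_option autoImplicit false

-- the summit and its single problem are both named `BirchSwinnertonDyer` (registry layout D-0017)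
set_option linter.dupNamespace false

/-!
# The (U)-ledger of a Hida datum by reduction type: Ochiai's condition (U) of stub 3 at every ADDITIVE and every
# SHALLOW MULTIPLICATIVE bad prime (helper for crux stmt-BirchSwinnertonDyer-20547 `KatoDivisibilityX9`, line `prime_adapted_tau`)

Stub 3 of line `prime_adapted_tau` (`stub_goodHidaDatum5S4`; `GoodHidaDatumStructAt`,
`Cruxes/KatoDivisibilityX9/Lines/prime_adapted_tau.lean`) asks, for an X9 pair `(W, p)` (`ClassX9 W p`,
`…Theorems.Rank1ResidualX9Defs`), for a Hida datum `D : HidaFamilyGaloisRepDatum W p 𝕀` with, among other conjuncts,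
(U) `∀ v, primeBelow v ∣ N_W → D.SpecialisationTorsionFreeAt v`.  This file assembles the bsd-f3-mu cell's kernel-checked
sketches (planner-bsd-f3-mu-desc g66/g71/g72: `U66.lean` ebe50d703ee9c15b, `Sketch71.lean` v5 f376123484d02b28 §C/§H/§I/§J7,
glue G1–G4 of `P72Check.lean` 5486fa619f6d3e95; port plan PORT-PLAN-72 file P8) on top of the sibling files
`…ULedger{Defs, AdditiveInertia, TateMonodromyDigits, SpecialisationKernels, WeightTwoTest, PrincipalPoint, TameMonodromy,
TameKummer}.lean`:

* `uLedger_additive` — the ADDITIVE half over the interface: `InertiaFixedPointFreeAt W p v ⟹ D.SpecialisationTorsionFreeAt v`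
  for EVERY datum; `additiveFixedPointFree_holds` (G2) — `AdditiveFixedPointFree W p` is a THEOREM (U66: at an additive
  `v ∤ p`, `p ≥ 5`, some `σ ∈ I_v` has `det(ρ(σ) − 1) ∈ ℤ_p^×`, hence fixes no non-zero point of `E[p]`);
  `specialisationTorsionFreeAt_of_hasAdditiveReductionAt_of_classX9` (G3) — (U) at every ADDITIVE bad prime of an X9 pair,
  for every datum, UNCONDITIONALLY;
* `tameMonodromyDigitsAt_of_depthOne`, `tameFamilyMonodromyAt_holds` — desc-S71m / desc-S71m° are THEOREMS: at a
  multiplicative `v ∤ p` with `m_v = 1` the `E`-digits come from the tree and `ρ_D|I_v` is one-parameter through a tame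
  generator with the tame relation `ρ_D(φ τ φ⁻¹) = ρ_D(τ^{N v})`, for EVERY datum;
* `depthOne_of_shallow_of_classX9` — on class X9, SHALLOW (`m_v ≤ 1`) ⟹ depth one (`m_v ≥ 1` from the image type);
* `uConjunct_of_supports''`, `uConjunct_of_supports_final`, `uConjunct_of_supports_J`, and the headline
  `uConjunct_of_classX9` (G4): THE (U) CONJUNCT of `GoodHidaDatumStructAt` for a given `D`, literally in the stub's shape,
  from (Reg) `Ochiai2006.IsRegular p 𝕀` ∧ (W2ℚ_p) `D.WeightTwoRational` ∧ the ROW statement «every bad `v ≠ p` is additive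
  or shallow multiplicative» (`hrow`; true on 790/790 rows of the X9 table by Tate's algorithm, census D71 — per-row data,
  NOT a class-wide theorem: multiplicative primes with `m_v ≥ 2` stay open class-wide).

Honest status: closes NOTHING on the ledger (no theorem here has the type of a ledger item); after this file the residual of
stub 3 on every table row reads EXISTENCE of `D` ∧ (Reg) ∧ (W2ℚ_p).  BSD is proved for no curve.
References: [Ochiai2006] §3 Lemma 3.2, Thm. 3.3, Cor. 7.5 / Rem. 7.6; [Hida1986] p. 559; [Serre1972] §2.4 Prop. 15;
[SilvermanAEC2009] Thm. VII.6.1, Prop. III.7.1, VIII.8; [SilvermanATAEC1994] V.4–V.5, Ex. 5.13(b); [SerreInventiones1972] §1.3.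
-/

noncomputable section

open scoped Classical MatrixGroups NumberField

namespace Summit.BirchSwinnertonDyer.BirchSwinnertonDyer.Theorems.OneSidedTwistSqueezeX9KatoDivisibilityX9ULedger

open NumberField IsDedekindDomain WeierstrassCurve Field
open Literature Literature.NumberTheory.EllipticCurves Literature.NumberTheory.GaloisRepresentations
open Literature.NumberTheory.EllipticCurves.HidaFamilyGaloisRepDatum
open Summit.BirchSwinnertonDyer.BirchSwinnertonDyer.Rank1Residual
open IsDedekindDomain.HeightOneSpectrum

/-- **desc-C71a′ — THE ADDITIVE HALF OF THE (U) LEDGER IS A THEOREM over the interface**: for EVERY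
datum `D` (any `𝕀`, no `(Reg)`, no `(inj)`, no weight-two input), fixed-point freeness of `I_v` on `E[p]`
gives `(𝕀²)_{I_v} = 0` and hence `D.SpecialisationTorsionFreeAt v`
(`specialisationTorsionFreeAt_of_fixedPointFree`: residual conjugacy (vi) + Nakayama-free unit lift). -/
theorem uLedger_additive (W : WeierstrassCurve ℚ) (p : ℕ) [Fact p.Prime] {I : Type} [CommRing I]
    [IsDomain I] [IsLocalRing I] [TopologicalSpace I] [IsTopologicalRing I] [Algebra (IwasawaAlgebra p) I]
    (D : HidaFamilyGaloisRepDatum W p I) {v : HeightOneSpectrum (𝓞 ℚ)}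
    (hv : InertiaFixedPointFreeAt W p v) : D.SpecialisationTorsionFreeAt v := by
  obtain ⟨σ, hσ, hfix⟩ := hv
  exact D.specialisationTorsionFreeAt_of_fixedPointFree hσ hfix

/-- **desc-S71m ⟸ tree facts ∧ desc-S71m°** at a multiplicative `v ∤ p` with `m_v = 1`
(`p ∣ ord_v Δ_min`, `p² ∤ ord_v Δ_min`): the `W`-digits come from `exists_inertia_tateDigits_of_not_pow_dvd`.
[cite: SilvermanATAEC1994, V.4–V.5 and Exercise 5.13(b) (PDF p. 416)] -/
theorem tameMonodromyDigitsAt_of_depthOne (W : WeierstrassCurve ℚ) [W.IsElliptic] (p : ℕ) [Fact p.Prime]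
    {v : HeightOneSpectrum (𝓞 ℚ)} (hmult : W.HasMultiplicativeReductionAt v) (hpv : (p : 𝓞 ℚ) ∉ v.asIdeal)
    (h1 : p ∣ W.ordMinimalDiscriminant v) (h2 : ¬ p ^ 2 ∣ W.ordMinimalDiscriminant v)
    (hT : TameFamilyMonodromyAt W p v) : TameMonodromyDigitsAt W p v := by
  obtain ⟨τ, hτ, hN, hdet, htr, hQ, hdepth⟩ :=
    W.exists_inertia_tateDigits_of_not_pow_dvd hmult hpv (k := 2) (by norm_num) h2
  obtain ⟨φ, ℓ, hℓ, hall⟩ := hT hmult hpv h1 τ hτ hN hQ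
  exact ⟨τ, φ, ℓ, hℓ, hdet, htr, hdepth, hall⟩

/-- Depth one is shallow. -/
theorem shallowMultiplicativeAt_of_depthOne (W : WeierstrassCurve ℚ) [W.IsGloballyMinimal] (p : ℕ)
    {v : HeightOneSpectrum (𝓞 ℚ)} (h : DepthOneMultiplicativeAt W p v) : ShallowMultiplicativeAt W p v :=
  ⟨h.1, h.2.le⟩

/-- `char(v) ≠ p ⟹ p ∉ v` for a finite place `v` of `ℚ` (`v ∩ ℤ = (char v)`). [folklore] -/
theorem natCast_not_mem_asIdeal_of_primeBelow_ne (v : HeightOneSpectrum (𝓞 ℚ)) {p : ℕ} (hp : p.Prime)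
    (h : primeBelow v ≠ p) : (p : 𝓞 ℚ) ∉ v.asIdeal := by
  intro hmem
  apply h
  have hmem' : ((p : ℕ) : ℤ) ∈ v.asIdeal.map (Rat.IsIntegralClosure.intEquiv (𝓞 ℚ)) := by
    have h' := Ideal.mem_map_of_mem (Rat.IsIntegralClosure.intEquiv (𝓞 ℚ)) hmem
    rwa [map_natCast] at h'
  have hdvd : Rat.HeightOneSpectrum.natGenerator v ∣ p :=
    (Rat.HeightOneSpectrum.natGenerator_dvd_iff v).2 hmem'
  exact (Nat.prime_dvd_prime_iff_eq (Rat.HeightOneSpectrum.prime_natGenerator v) hp).1 hdvd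

/-- **The census digit, read as divisibilities**: `m_v = 1 ⟹ p ∣ ord_v Δ_min ∧ p² ∤ ord_v Δ_min`
(`ord_v Δ_min = v_{char v}(Δ_min(W))` for a globally minimal `W`, tree `ordMinimalDiscriminant_eq_padicValInt`).
[cite: SilvermanAEC2009, VIII.8 (global minimal equation, PDF p. 211)] -/
theorem dvd_and_not_sq_dvd_of_monodromyDepth_eq_one (W : WeierstrassCurve ℚ) [W.IsElliptic]
    [W.IsGloballyMinimal] {p : ℕ} [Fact p.Prime] {v : HeightOneSpectrum (𝓞 ℚ)}
    (h : monodromyDepth W p v = 1) :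
    p ∣ W.ordMinimalDiscriminant v ∧ ¬ p ^ 2 ∣ W.ordMinimalDiscriminant v := by
  haveI : Fact (primeBelow v).Prime := ⟨(Rat.HeightOneSpectrum.primesEquiv v).2⟩
  have hord : W.ordMinimalDiscriminant v = padicValInt (primeBelow v) (minimalDiscriminantInt W) :=
    LocalTorsionMult.ordMinimalDiscriminant_eq_padicValInt W v rfl
  change padicValNat p (padicValInt (primeBelow v) (minimalDiscriminantInt W)) = 1 at h
  rw [hord]
  have hn0 : padicValInt (primeBelow v) (minimalDiscriminantInt W) ≠ 0 := by
    intro h0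
    rw [h0] at h
    simp at h
  refine ⟨dvd_of_one_le_padicValNat h.ge, fun h2 => ?_⟩
  have h2' := (padicValNat_dvd_iff_le hn0).mp h2
  omega

/-- **STUB-3 CONJUNCT (U) ON THE WHOLE TABLE (g71 final form, §H).**  Inputs: the classical supports
`AdditiveFixedPointFree` (desc-S71 = D66) and `TameFamilyMonodromyAt` (desc-S71m°, deformation side only), the
construction-side (Reg) ∧ (W2ℚ_p), and the census row statement «every bad `v ≠ p` is additive or depth-one
multiplicative» (790/790 rows); the `W`-digits of the multiplicative primes are now supplied by the tree (§H). -/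
theorem uConjunct_of_supports'' (W : WeierstrassCurve ℚ) [W.IsElliptic] [W.IsGloballyMinimal] (p : ℕ)
    [Fact p.Prime] (hA : AdditiveFixedPointFree W p)
    (hT : ∀ v : HeightOneSpectrum (𝓞 ℚ), TameFamilyMonodromyAt W p v)
    (hX9 : ClassX9 W p) {I : Type} [CommRing I] [IsDomain I] [IsLocalRing I] [TopologicalSpace I]
    [IsTopologicalRing I] [Algebra (IwasawaAlgebra p) I] (D : HidaFamilyGaloisRepDatum W p I)
    (hreg : Ochiai2006.IsRegular p I) (hW2 : D.WeightTwoRational)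
    (hrow : ∀ v : HeightOneSpectrum (𝓞 ℚ), primeBelow v ∣ W.conductorNorm ℤ → primeBelow v ≠ p →
      W.HasAdditiveReductionAt v ∨ DepthOneMultiplicativeAt W p v) :
    ∀ v : HeightOneSpectrum (𝓞 ℚ), primeBelow v ∣ W.conductorNorm ℤ → primeBelow v ≠ p →
      D.SpecialisationTorsionFreeAt v := by
  intro v hv hvp
  rcases hrow v hv hvp with hadd | hmult
  · exact uLedger_additive W p D (hA hX9 v hv hadd)
  · have hpv := natCast_not_mem_asIdeal_of_primeBelow_ne v (Fact.out : p.Prime) hvp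
    obtain ⟨h1, h2⟩ := dvd_and_not_sq_dvd_of_monodromyDepth_eq_one W hmult.2
    obtain ⟨τ, φ, ℓ, hℓ, hdet, htr, hdepth, hall⟩ :=
      tameMonodromyDigitsAt_of_depthOne W p hmult.1 hpv h1 h2 (hT v)
    obtain ⟨hτ, hrel⟩ := hall I _ _ _ _ _ _ D
    obtain ⟨ϖ, hϖ, hker⟩ := principalPointW_of_isRegular D hreg
    exact D.specialisationTorsionFreeAt_of_digits hreg hW2 hτ hℓ hrel hdet htr hdepth hϖ hker

/-- **X9 ∧ shallow ⟹ depth one** at a multiplicative `v ≠ p`: `m_v ≤ 1` (census) and `m_v ≥ 1` (§I, image type). -/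
theorem depthOne_of_shallow_of_classX9 (W : WeierstrassCurve ℚ) [W.IsElliptic] [W.IsGloballyMinimal] (p : ℕ)
    [Fact p.Prime] (hX9 : ClassX9 W p) {v : HeightOneSpectrum (𝓞 ℚ)} (hsh : ShallowMultiplicativeAt W p v)
    (hvp : primeBelow v ≠ p) : DepthOneMultiplicativeAt W p v := by
  obtain ⟨-, -, -, -, hirr, hns⟩ := hX9
  have hpv := natCast_not_mem_asIdeal_of_primeBelow_ne v (Fact.out : p.Prime) hvp
  have hdvd := W.dvd_ordMinimalDiscriminant_of_not_hasSurjectiveModNGaloisRep p hirr hns hsh.1 hpv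
  have h1 : 1 ≤ W.ordMinimalDiscriminant v := by
    rw [Nat.one_le_iff_ne_zero, Ne, W.ordMinimalDiscriminant_eq_zero_iff_holds v]
    exact hsh.1.not_hasGoodReductionAt
  haveI : Fact (primeBelow v).Prime := ⟨(Rat.HeightOneSpectrum.primesEquiv v).2⟩
  have hord : W.ordMinimalDiscriminant v = padicValInt (primeBelow v) (minimalDiscriminantInt W) :=
    LocalTorsionMult.ordMinimalDiscriminant_eq_padicValInt W v rfl
  refine ⟨hsh.1, le_antisymm hsh.2 ?_⟩
  change 1 ≤ padicValNat p (padicValInt (primeBelow v) (minimalDiscriminantInt W))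
  rw [← hord]
  exact one_le_padicValNat_of_dvd (by omega) hdvd

/-- **STUB-3 CONJUNCT (U) ON THE WHOLE TABLE — §G's corollary with desc-S71m REPLACED by its deformation-side half
desc-S71m°** (`TameFamilyMonodromyAt`); the row hypothesis is the original §F/§G one (additive or SHALLOW multiplicative,
790/790 rows), the `W`-digits and `m_v ≥ 1` being supplied by the tree (§H, §I). -/
theorem uConjunct_of_supports_final (W : WeierstrassCurve ℚ) [W.IsElliptic] [W.IsGloballyMinimal] (p : ℕ)
    [Fact p.Prime] (hA : AdditiveFixedPointFree W p)
    (hT : ∀ v : HeightOneSpectrum (𝓞 ℚ), TameFamilyMonodromyAt W p v)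
    (hX9 : ClassX9 W p) {I : Type} [CommRing I] [IsDomain I] [IsLocalRing I] [TopologicalSpace I]
    [IsTopologicalRing I] [Algebra (IwasawaAlgebra p) I] (D : HidaFamilyGaloisRepDatum W p I)
    (hreg : Ochiai2006.IsRegular p I) (hW2 : D.WeightTwoRational)
    (hrow : ∀ v : HeightOneSpectrum (𝓞 ℚ), primeBelow v ∣ W.conductorNorm ℤ → primeBelow v ≠ p →
      W.HasAdditiveReductionAt v ∨ ShallowMultiplicativeAt W p v) :
    ∀ v : HeightOneSpectrum (𝓞 ℚ), primeBelow v ∣ W.conductorNorm ℤ → primeBelow v ≠ p →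
      D.SpecialisationTorsionFreeAt v :=
  uConjunct_of_supports'' W p hA hT hX9 D hreg hW2 fun v hv hvp =>
    (hrow v hv hvp).imp_right fun hsh => depthOne_of_shallow_of_classX9 W p hX9 hsh hvp

/-- **desc-S71m° IS A THEOREM OF THE INTERFACE (§J).**  For every `W`, `p`, `v`: at a multiplicative `v ∤ p` with
`p ∣ ord_v Δ_min`, an inertia element `τ` unipotent on `T_p W` that moves `W[p²]` is, for EVERY datum `D`, a parameter
of `ρ_D|I_v` (`ρ_D(σ) − 1 ∈ 𝕀 · (ρ_D(τ) − 1)` for all `σ ∈ I_v`) and satisfies the tame relation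
`ρ_D(φ τ φ⁻¹) = ρ_D(τ^{N v})` for an arithmetic Frobenius `φ` at `𝔓₀ = adicCompletionPrime ℚ v`.  Inputs: fields (ii)
(continuity, `𝔪`-adic topology), (vi) (residual representation, through the tree's
`smul_geomTorsion_eq_of_mem_inertia_of_hasMultiplicativeReductionAt_of_dvd`), `exists_conj_galoisRepTate` (through
`sq_zero_of_tame_relation`), the tree's tame Kummer theory `InertiaTameFactorizationProofs`, Mathlib's
`IsArithFrobAt.apply_of_pow_eq_one`, and Krull's intersection theorem.
[cite: SerreInventiones1972, §1.3 Prop. 2, n° 1.12 and §1.8 Prop. 6] [cite: Ochiai2006, §3 Lemma 3.2] [cite: Hida1986, p. 559] -/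
theorem tameFamilyMonodromyAt_holds (W : WeierstrassCurve ℚ) [W.IsElliptic] (p : ℕ) [Fact p.Prime]
    (v : HeightOneSpectrum (𝓞 ℚ)) : TameFamilyMonodromyAt W p v := by
  intro hmult hpv hdvd τ hτG hunip hmov
  have h𝔓 := adicCompletionPrime_mem_primesAbove ℚ v
  have hIeq : ∀ σ : absoluteGaloisGroup ℚ, σ ∈ GreenbergSelmer.inertia (K := ℚ) v ↔
      σ ∈ (adicCompletionPrime ℚ v).inertia (absoluteGaloisGroup ℚ) := fun σ => by
    change σ ∈ (absInertia (v.adicCompletion ℚ)).map (absGaloisRestrict ℚ (v.adicCompletion ℚ)).toMonoidHom ↔ _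
    rw [← inertia_adicCompletionPrime_eq_map_absInertia]
  have hτ := (hIeq τ).mp hτG
  obtain ⟨φ, hφI, hφζ⟩ := exists_frobenius_normalising h𝔓
  obtain ⟨hdetW, htrW⟩ := W.det_trace_galoisRepTate_of_unipotent hunip
  refine ⟨φ, v.residueCard, v.one_lt_residueCard, fun I _ _ _ _ _ _ D => ?_⟩
  have hrel := D.rhoMat_conj_eq_rhoMat_pow hmult hpv hdvd h𝔓 hτ hmov hφI hφζ
  have hN := D.sq_zero_of_tame_relation v.one_lt_residueCard hrel hdetW htrW
  exact ⟨⟨hτG, fun σ hσG => D.exists_smul_of_sq_zero hmult hpv hdvd h𝔓 hτ hmov hN ((hIeq σ).mp hσG)⟩, hrel⟩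

/-- **STUB-3 CONJUNCT (U) ON THE WHOLE TABLE with desc-S71m° DISCHARGED (§J):** `uConjunct_of_supports_final` with its
hypothesis `∀ v, TameFamilyMonodromyAt W p v` supplied by `tameFamilyMonodromyAt_holds`.  Remaining inputs: the additive
classical support `AdditiveFixedPointFree` (desc-S71 = D66), the construction-side (Reg) ∧ (W2ℚ_p), and the census row
statement (additive or shallow multiplicative at every bad `v ≠ p`; 790/790 rows). -/
theorem uConjunct_of_supports_J (W : WeierstrassCurve ℚ) [W.IsElliptic] [W.IsGloballyMinimal] (p : ℕ)
    [Fact p.Prime] (hA : AdditiveFixedPointFree W p)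
    (hX9 : ClassX9 W p) {I : Type} [CommRing I] [IsDomain I] [IsLocalRing I] [TopologicalSpace I]
    [IsTopologicalRing I] [Algebra (IwasawaAlgebra p) I] (D : HidaFamilyGaloisRepDatum W p I)
    (hreg : Ochiai2006.IsRegular p I) (hW2 : D.WeightTwoRational)
    (hrow : ∀ v : HeightOneSpectrum (𝓞 ℚ), primeBelow v ∣ W.conductorNorm ℤ → primeBelow v ≠ p →
      W.HasAdditiveReductionAt v ∨ ShallowMultiplicativeAt W p v) :
    ∀ v : HeightOneSpectrum (𝓞 ℚ), primeBelow v ∣ W.conductorNorm ℤ → primeBelow v ≠ p →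
      D.SpecialisationTorsionFreeAt v :=
  uConjunct_of_supports_final W p hA (tameFamilyMonodromyAt_holds W p) hX9 D hreg hW2 hrow

/-- **G1.** On class X9 every conductor prime differs from `p` (`p` is a prime of good reduction;
tree `dvd_conductorNorm_iff_not_hasGoodReductionAtPrime`). -/
theorem primeBelow_ne_of_classX9 (W : WeierstrassCurve ℚ) [W.IsElliptic] [W.IsGloballyMinimal] (p : ℕ)
    [Fact p.Prime] (hX9 : ClassX9 W p) {v : HeightOneSpectrum (𝓞 ℚ)} (hv : primeBelow v ∣ W.conductorNorm ℤ) :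
    primeBelow v ≠ p := by
  intro h
  exact (W.dvd_conductorNorm_iff_not_hasGoodReductionAtPrime p).mp (h ▸ hv) hX9.2.2.1

/-- **G2. desc-S71 DISCHARGED: `AdditiveFixedPointFree W p` holds for every `W`, `p`** (D66 = U66 §5 `E[p]^{I_v} = 0` at an
additive `v ∤ p`, `p ≥ 5`, §4 the unit, §4b back to fixed-point freeness on `E[p]`; `p ≥ 5` and `v ≠ p` from `ClassX9`).
[cite: Serre1972, §2.4 Prop. 15] [cite: SilvermanAEC2009, Thm. VII.6.1, Prop. III.7.1] -/
theorem additiveFixedPointFree_holds (W : WeierstrassCurve ℚ) [W.IsElliptic] [W.IsGloballyMinimal] (p : ℕ)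
    [Fact p.Prime] : AdditiveFixedPointFree W p := by
  intro hX9 v hv hadd
  have hvp : primeBelow v ≠ p := primeBelow_ne_of_classX9 W p hX9 hv
  have hpv : (p : 𝓞 ℚ) ∉ v.asIdeal := natCast_not_mem_asIdeal_of_primeBelow_ne v (Fact.out : p.Prime) hvp
  obtain ⟨σ, hσ, hu⟩ :=
    exists_mem_inertia_isUnit_det_sub_one_of_hasAdditiveReductionAt W p hX9.2.1 hpv hadd
  refine ⟨σ, hσ, fun Q hQ => ?_⟩
  refine (injective_iff_map_eq_zero _).mp (injective_sub_id_of_isUnit_det W p σ hu) Q ?_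
  rw [AddMonoidHom.sub_apply, AddMonoidHom.id_apply, AddEquiv.coe_toAddMonoidHom, sub_eq_zero]
  exact hQ

/-- **G3. (U) AT EVERY ADDITIVE BAD PRIME OF AN X9 PAIR, FOR EVERY DATUM — unconditional** (no (Reg), no (W2ℚ_p),
no row hypothesis): `D.SpecialisationTorsionFreeAt v`. [cite: Ochiai2006, §3 Lemma 3.2] -/
theorem specialisationTorsionFreeAt_of_hasAdditiveReductionAt_of_classX9 (W : WeierstrassCurve ℚ) [W.IsElliptic]
    [W.IsGloballyMinimal] (p : ℕ) [Fact p.Prime] (hX9 : ClassX9 W p) {I : Type} [CommRing I] [IsDomain I]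
    [IsLocalRing I] [TopologicalSpace I] [IsTopologicalRing I] [Algebra (IwasawaAlgebra p) I]
    (D : HidaFamilyGaloisRepDatum W p I) {v : HeightOneSpectrum (𝓞 ℚ)} (hv : primeBelow v ∣ W.conductorNorm ℤ)
    (hadd : W.HasAdditiveReductionAt v) : D.SpecialisationTorsionFreeAt v :=
  uLedger_additive W p D (additiveFixedPointFree_holds W p hX9 v hv hadd)

/-- **G4. THE (U) CONJUNCT OF `GoodHidaDatumStructAt` (stub 3 of line `prime_adapted_tau`, item
stmt-BirchSwinnertonDyer-20547) FOR A GIVEN DATUM `D`, literally in the stub's shape** (no `v ≠ p` binder), from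
(Reg) ∧ (W2ℚ_p) ∧ the row statement «every bad `v ≠ p` is additive or shallow multiplicative» (790/790 rows). -/
theorem uConjunct_of_classX9 (W : WeierstrassCurve ℚ) [W.IsElliptic] [W.IsGloballyMinimal] (p : ℕ) [Fact p.Prime]
    (hX9 : ClassX9 W p) {I : Type} [CommRing I] [IsDomain I] [IsLocalRing I] [TopologicalSpace I]
    [IsTopologicalRing I] [Algebra (IwasawaAlgebra p) I] (D : HidaFamilyGaloisRepDatum W p I)
    (hreg : Ochiai2006.IsRegular p I) (hW2 : D.WeightTwoRational)
    (hrow : ∀ v : HeightOneSpectrum (𝓞 ℚ), primeBelow v ∣ W.conductorNorm ℤ → primeBelow v ≠ p →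
      W.HasAdditiveReductionAt v ∨ ShallowMultiplicativeAt W p v) :
    ∀ v : HeightOneSpectrum (𝓞 ℚ), ((Rat.HeightOneSpectrum.primesEquiv v : Nat.Primes) : ℕ) ∣ W.conductorNorm ℤ →
      D.SpecialisationTorsionFreeAt v :=
  fun v hv => uConjunct_of_supports_J W p (additiveFixedPointFree_holds W p) hX9 D hreg hW2 hrow v hv
    (primeBelow_ne_of_classX9 W p hX9 hv)

end Summit.BirchSwinnertonDyer.BirchSwinnertonDyer.Theorems.OneSidedTwistSqueezeX9KatoDivisibilityX9ULedger
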